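import Summits.QuantumFields.YangMills.Theorems.UnitScaleTiltProp8ChartDoubleBarDet
import Summits.QuantumFields.YangMills.Theorems.UnitScaleTiltProp8ChartKernelTube
import Literature.MathematicalPhysics.QuantumFieldTheory.BalabanImbrieJaffe1984to88.BIJ85ContourLocality
import HarnessLib

/-!
# Route `UnitScaleTilt`, crux K1 «MinimiserStabilityRegPr» (stmt-QuantumFields-19200), stub V2′ `stub_halvingStep` — pillar P3, the double-bar chart of record:
# **ABELIAN EXACTNESS: AT `𝔸 = ℂ` THE DOUBLE-BAR CHART IS ITS LINEARISATION, `Q♭_ℂ(z)(j,c) = η·Lʲ·Q_j(z)(c)`**, hence with ✓`trace_chartLogFlat_eq_of_reads` (the determinant through the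
# tower) and CERT-2: **`tr C♭(A)(j,c) = 0` for EVERY field in the ball** — the remainder of the double-bar chart is 𝔰𝔩₂-valued ([Balaban1985Variational] (47): `D` is 𝔤-valued),
# and the small solution `Dsel` of (49) is traceless with no uniqueness argument (★★OWNER ACK 34 (3): route (ab), file 2 of 2; census row S11 `hU`)

Cell `ym3-torus` (HUMAN RULING D-0037: YM₃ on the torus is ladder rung R3, not the Clay problem), width seat `ym-ust-19200-w8` g0∕s2.
`--supports stmt-QuantumFields-19200 --as helper`; definition-free, 0 sorry.

WHAT THIS FILE PROVES (no definition, no sorry):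
* §1 (scalar fields, `𝔸 = ℂ`) `holT_coe_eq_exp_walkSum` (transport = `exp` of the signed sum), `norm_walkSum_le_of_steps`, `emlUnit_coe_eq_exp_mean` (`exp[mean log]` of exponentials
  = exponential of the mean, below `ln 2`).
* §2 **`dbarAvgU_coe_eq_exp_abelian`** — ONE (89) step at `𝔸 = ℂ` is EXACTLY `U̿(c) = exp(L·(Q w)(c))` for `U = exp∘w` on the two blocks (`2ℓt ≤ 1`): the frame means cancel the comb
  sums exactly (✓`walkSum_walk_loopWord`, ✓`sum_idx_swap`, ✓`tubeCLM_formula_eq_smul_bondAvg`); **`dbarIterU_coe_eq_exp_abelian`** — the tower: `U̿^{(i)}(e^{iηz})(e) =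
  exp(iη·Lⁱ·Q_i z(e))` on the read territory (`2ℓ|η|Lⁱt ≤ 1`, ✓`BIJ85ContourLocality.norm_bondAvgIter_le_tower`).
* §3 ★★ **`chartLogFlat_abelian_of_reads`**: `chartLogFlat η D z (j,c) = η·Lʲ·Q_j z(c)` at `𝔸 = ℂ`; ★★★ **`trace_chartRemainderFlat_eq_zero_weightedBall₀`**: for EVERY `A` in the weighted
  ball of record (`60800·ℓ²·L·R ≤ 1`), `tr (chartLogFlat η D A (j,c) − (fderiv (chartLogFlat η D) 0 A) (j,c)) = 0`; corollary ★★ **`trace_dsel_eq_zero_of_eq49`**: any datum of the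
  form `Dv = C♭(A′ − Hs Dv)` with the dressed point in the ball is traceless, and so is the dressed field when `A′` is (`Hs` trace-compatible).
HONEST SCOPE.  Bookkeeping over landed letters.  NOT a claim about the stub, the crux, the rung or the mass gap.

References: T. Bałaban, CMP **102** (1985) [Balaban1985Variational] (20) p.281, (44)–(49) pp.285–286; CMP **98** (1985) [Balaban1985Averaging] (89) p.31, (122)–(125) p.36;
CMP **95** (1984) [Balaban1984PropagatorsI] (1.11), (1.18) pp.19–20.
-/

set_option autoImplicit false

noncomputable section

open scoped BigOperators
open NormedSpace

namespace Summit.QuantumFields.YangMills.Theorems.Prop8ChartDoubleBar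

open Literature.MathematicalPhysics.QuantumFieldTheory.Balaban1983to89
open T4Continuum BlockAveraging AveragingRT ExpMeanLog MatrixLog BlockAveragingEMLLinearised LatticeFieldCalculus
open B10Eq27TorusAxialLog (holT holT_nil holT_cons_true holT_cons_false)
open B5Eq118OneStroke (iterBlockOf iterBlockOf_succ iterBlockOf_zero)
open B6SectADomainsV1 (Domains)
open B6SectAOperatorsV1 (BondIdx)
open T3ContinuumYM3Torus (T3Family)
open Summit.QuantumFields.YangMills.Theorems.FlatCubeOpsText (IsLevWeight)
open Summit.QuantumFields.YangMills.Theorems.Prop8Chart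
open B7BlockAvgLog (mlog_exp)
open LatticeWordStokes (length_loopWord_le)
open Literature.MathematicalPhysics.QuantumFieldTheory.BalabanImbrieJaffe1984to88 (BIJ85GaugeFunction5113.blk)
open Literature.MathematicalPhysics.QuantumFieldTheory.BalabanImbrieJaffe1984to88.BIJ85ContourLocality (norm_bondAvgIter_le_tower)

variable {P : Params}

/-! ## §1 Scalar transports and the scalar `exp[mean log]` -/

section Scalar

variable {j : ℕ}

/-- **ABELIAN TRANSPORT**: for a `ℂˣ`-field with `S(b) = e^{w(b)}` on the bonds read by a walk, the transporter is `e^{Σ ± w}`. [cite: Balaban1984PropagatorsI, (1.8) p.19] -/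
theorem holT_coe_eq_exp_walkSum (S : GaugeField P j ℂˣ) (w : PBond P j → ℂ) :
    ∀ (x : Site P j) (word : List (Letter P.d)), (∀ st ∈ walk x word, ((S st.bond : ℂˣ) : ℂ) = Complex.exp (w st.bond)) →
      ((holT S x word : ℂˣ) : ℂ) = Complex.exp (walkSum w (walk x word))
  | x, [], _ => by rw [holT_nil, Units.val_one]; simp [walk, walkSum_nil]
  | x, (μ, true) :: word, h => by
    have hcons : walk x ((μ, true) :: word) = ⟨⟨x, μ⟩, true⟩ :: walk (x.shift μ) word := rfl
    rw [holT_cons_true, Units.val_mul, hcons, walkSum_cons, if_pos rfl, Complex.exp_add,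
      h ⟨⟨x, μ⟩, true⟩ (by rw [hcons]; exact List.mem_cons_self),
      holT_coe_eq_exp_walkSum S w (x.shift μ) word fun st hst => h st (by rw [hcons]; exact List.mem_cons_of_mem _ hst)]
  | x, (μ, false) :: word, h => by
    have hcons : walk x ((μ, false) :: word) = ⟨⟨x.unshift μ, μ⟩, false⟩ :: walk (x.unshift μ) word := rfl
    rw [holT_cons_false, Units.val_mul, Units.val_inv_eq_inv_val, hcons, walkSum_cons, if_neg Bool.false_ne_true, Complex.exp_add, Complex.exp_neg,
      h ⟨⟨x.unshift μ, μ⟩, false⟩ (by rw [hcons]; exact List.mem_cons_self),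
      holT_coe_eq_exp_walkSum S w (x.unshift μ) word fun st hst => h st (by rw [hcons]; exact List.mem_cons_of_mem _ hst)]

/-- the signed sum along a walk whose bonds are bounded by `t` is at most `length·t`. [cite: Balaban1984PropagatorsI, (1.8) p.19] -/
theorem norm_walkSum_le_of_steps (w : PBond P j → ℂ) {t : ℝ} :
    ∀ γ : List (LStep P j), (∀ st ∈ γ, ‖w st.bond‖ ≤ t) → ‖walkSum w γ‖ ≤ γ.length * t
  | [], _ => by simp [walkSum_nil]
  | st :: γ, h => by
    rw [walkSum_cons, List.length_cons, Nat.cast_succ, add_mul, one_mul, add_comm ((γ.length : ℝ) * t)]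
    refine (norm_add_le _ _).trans (add_le_add ?_ (norm_walkSum_le_of_steps w γ fun st' hst' => h st' (List.mem_cons_of_mem _ hst')))
    have := h st List.mem_cons_self
    split_ifs
    · exact this
    · rw [norm_neg]; exact this

/-- **SCALAR `exp[mean log]` OF EXPONENTIALS**: for `Wᵢ = e^{uᵢ}` with `|uᵢ| < ln 2`, `eml W = e^{mean uᵢ}` (`log∘exp = id` below `ln 2`). [cite: Balaban1987RG1, (0.4) p.253] -/
theorem emlUnit_coe_eq_exp_mean {u : Idx P → ℂ} {W : Idx P → ℂ} (hW : ∀ i, W i = Complex.exp (u i)) (hu : ∀ i, ‖u i‖ < Real.log 2) :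
    (((isUnit_eml W).unit : ℂˣ) : ℂ) = Complex.exp (((Fintype.card (Idx P) : ℂ))⁻¹ * ∑ i, u i) := by
  rw [IsUnit.unit_spec, eml_eq_exp, Complex.exp_eq_exp_ℂ, smul_eq_mul]
  congr 2
  exact Finset.sum_congr rfl fun i _ => by rw [hW i, Complex.exp_eq_exp_ℂ, mlog_exp (hu i)]

end Scalar

/-! ## §2 One double-bar step and the tower at `𝔸 = ℂ`: exact -/

section Step

variable {j : ℕ}

/-- **THE FRAME MEANS CANCEL THE COMB SUMS EXACTLY**: `−a(y) + |I|⁻¹Σᵢ w(loopᵢ) + w([y,y′]_L) + a(y′) = L·(Q w)(c)` with `a(y) = |I|⁻¹Σᵢ w(Γ^{σᵢ}_{y→xᵢ})` — the exponent identity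
behind (89) at an abelian field (✓`walkSum_walk_loopWord`, ✓`sum_idx_swap`, ✓`tubeCLM_formula_eq_smul_bondAvg`). [cite: Balaban1985Averaging, (122)-(125) p.36; Balaban1984PropagatorsI, (1.11) p.19] -/
theorem abelian_exponent_eq (w : PBond P j → ℂ) (c : PBond P (j + 1)) :
    -(((Fintype.card (Idx P) : ℂ))⁻¹ * ∑ i : Idx P, walkSum w (walk (emb c.src) (stairWord i.2.1 (off i.1)))) +
      (((Fintype.card (Idx P) : ℂ))⁻¹ * ∑ i : Idx P, walkSum w (walk (emb c.src) (loopWord P.L c.dir (off i.1) i.2.1 i.2.2)) +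
        walkSum w (walk (emb c.src) (List.replicate P.L (c.dir, true)))) +
      ((Fintype.card (Idx P) : ℂ))⁻¹ * ∑ i : Idx P, walkSum w (walk (emb c.tgt) (stairWord i.2.1 (off i.1))) = (P.L : ℝ) • bondAvg w c := by
  have hI : (Fintype.card (Idx P) : ℂ) ≠ 0 := Nat.cast_ne_zero.mpr Fintype.card_pos.ne'
  -- split the loop sums into their four segments
  have hloops : ∑ i : Idx P, walkSum w (walk (emb c.src) (loopWord P.L c.dir (off i.1) i.2.1 i.2.2)) =
      ∑ i : Idx P, walkSum w (walk (emb c.src) (stairWord i.2.1 (off i.1))) +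
        ∑ i : Idx P, walkSum w (walk (walkEnd (emb c.src) (stairWord i.2.1 (off i.1))) (List.replicate P.L (c.dir, true))) -
        ∑ i : Idx P, walkSum w (walk (emb c.tgt) (stairWord i.2.2 (off i.1))) -
        (Fintype.card (Idx P) : ℂ) * walkSum w (walk (emb c.src) (List.replicate P.L (c.dir, true))) := by
    simp only [walkSum_walk_loopWord, Finset.sum_sub_distrib, Finset.sum_add_distrib, Finset.sum_const, Finset.card_univ, nsmul_eq_mul]
  -- the second staircase family is the comb family at `c₊`
  have hσ' : ∑ i : Idx P, walkSum w (walk (emb c.tgt) (stairWord i.2.2 (off i.1))) =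
      ∑ i : Idx P, walkSum w (walk (emb c.tgt) (stairWord i.2.1 (off i.1))) :=
    sum_idx_swap fun r σ => walkSum w (walk (emb c.tgt) (stairWord σ (off r)))
  -- the straight segments: a function of the offset alone, `segSum` at the block sites
  have hseg : ∑ i : Idx P, walkSum w (walk (walkEnd (emb c.src) (stairWord i.2.1 (off i.1))) (List.replicate P.L (c.dir, true))) =
      (Fintype.card (Equiv.Perm (Fin P.d)) ^ 2) • ∑ r : Fin P.d → Fin P.L, segSum w (Site.blockSite c.src r) c.dir P.L := by
    rw [← sum_idx_of_fst]
    refine Finset.sum_congr rfl fun i _ => ?_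
    rw [walkEnd_emb_stairWord_eq_blockSite, walkSum_walk_replicate]
  -- the normalisation `|I|⁻¹·|S_d|² = L·L^{−(d+1)}`
  have hL : (P.L : ℂ) ≠ 0 := Nat.cast_ne_zero.mpr P.L_pos.ne'
  have hS : (Fintype.card (Equiv.Perm (Fin P.d)) : ℂ) ≠ 0 := Nat.cast_ne_zero.mpr Fintype.card_pos.ne'
  have hnorm : ((Fintype.card (Idx P) : ℂ))⁻¹ * ((Fintype.card (Equiv.Perm (Fin P.d)) ^ 2) • ∑ r : Fin P.d → Fin P.L, segSum w (Site.blockSite c.src r) c.dir P.L) =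
      (P.L : ℝ) • bondAvg w c := by
    rw [← ChartKernelTube.tubeCLM_formula_eq_smul_bondAvg, ← Nat.cast_smul_eq_nsmul ℂ, smul_eq_mul, smul_eq_mul, smul_eq_mul, ← mul_assoc, ← mul_assoc, card_idx]
    congr 1
    push_cast
    field_simp
    ring
  rw [hloops, hσ', hseg, ← hnorm]
  field_simp
  ring

/-- **ONE (89) STEP AT `𝔸 = ℂ` IS EXACT**: if `S(b) = e^{w(b)}`, `|w(b)| ≤ t` on the two-block bonds of `c` and `2ℓt ≤ 1` (`ℓ = (d+2)L` bounds every walk read), then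
`U̿(c) = exp(L·(Q w)(c))`. [cite: Balaban1985Averaging, (89) p.31, (122)-(125) p.36] -/
theorem dbarAvgU_coe_eq_exp_abelian (hj : j + 1 ≤ P.m + P.K) {S : GaugeField P j ℂˣ} (c : PBond P (j + 1)) {w : PBond P j → ℂ} {t : ℝ} (ht0 : 0 ≤ t)
    (hℓt : 2 * (((P.d + 2) * P.L : ℕ) : ℝ) * t ≤ 1)
    (hS : ∀ b : PBond P j, (blockOf b.src = c.src ∨ blockOf b.src = c.tgt) → (blockOf b.tgt = c.src ∨ blockOf b.tgt = c.tgt) →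
      ((S b : ℂˣ) : ℂ) = Complex.exp (w b))
    (hw : ∀ b : PBond P j, (blockOf b.src = c.src ∨ blockOf b.src = c.tgt) → (blockOf b.tgt = c.src ∨ blockOf b.tgt = c.tgt) → ‖w b‖ ≤ t) :
    ((dbarAvgU S c : ℂˣ) : ℂ) = Complex.exp ((P.L : ℝ) • bondAvg w c) := by
  set ℓ : ℝ := (((P.d + 2) * P.L : ℕ) : ℝ) with hℓ
  have hlog2 := Real.log_two_gt_d9
  -- every walk read here has at most `ℓ` steps, so its signed sum is below `ℓt ≤ ½ < ln 2`
  have hsum_lt : ∀ (x : Site P j) (word : List (Letter P.d)), (walk x word).length ≤ (P.d + 2) * P.L →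
      (∀ st ∈ walk x word, ‖w st.bond‖ ≤ t) → ‖walkSum w (walk x word)‖ < Real.log 2 := by
    intro x word hlen hst
    have h1 := norm_walkSum_le_of_steps w (walk x word) hst
    have h2 : ((walk x word).length : ℝ) * t ≤ ℓ * t := by
      refine mul_le_mul_of_nonneg_right ?_ ht0
      rw [hℓ]; exact_mod_cast hlen
    nlinarith
  -- the frames
  have hframe : ∀ y : Site P (j + 1), (y = c.src ∨ y = c.tgt) →
      ((vframeU S y : ℂˣ) : ℂ) = Complex.exp (((Fintype.card (Idx P) : ℂ))⁻¹ * ∑ i : Idx P, walkSum w (walk (emb y) (stairWord i.2.1 (off i.1)))) := by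
    intro y hy
    unfold vframeU
    have hreads : ∀ (i : Idx P), ∀ st ∈ walk (emb y) (stairWord i.2.1 (off i.1)),
        (blockOf st.bond.src = c.src ∨ blockOf st.bond.src = c.tgt) ∧ (blockOf st.bond.tgt = c.src ∨ blockOf st.bond.tgt = c.tgt) := by
      intro i st hst
      obtain ⟨h1, h2⟩ := blockOf_ends_of_mem_stairWalk hj y i.1 i.2.1 st hst
      rw [h1, h2]
      rcases hy with h | h <;> rw [h]
      · exact ⟨Or.inl rfl, Or.inl rfl⟩
      · exact ⟨Or.inr rfl, Or.inr rfl⟩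
    refine emlUnit_coe_eq_exp_mean (fun i => holT_coe_eq_exp_walkSum S w _ _ fun st hst => hS st.bond (hreads i st hst).1 (hreads i st hst).2) fun i =>
      hsum_lt _ _ (length_walk_stairWord_le _ _ _) fun st hst => hw st.bond (hreads i st hst).1 (hreads i st hst).2
  -- the single-bar average
  have havg : ((emlAvgU S c : ℂˣ) : ℂ) =
      Complex.exp (((Fintype.card (Idx P) : ℂ))⁻¹ * ∑ i : Idx P, walkSum w (walk (emb c.src) (loopWord P.L c.dir (off i.1) i.2.1 i.2.2))) *
        Complex.exp (walkSum w (walk (emb c.src) (List.replicate P.L (c.dir, true)))) := by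
    rw [coe_emlAvgU]
    congr 1
    · rw [← IsUnit.unit_spec (isUnit_eml fun i : Idx P => ((loopHolU S c i : ℂˣ) : ℂ))]
      refine emlUnit_coe_eq_exp_mean (fun i => ?_) fun i => hsum_lt _ _ ((length_walk _ _).le.trans (length_loopWord_le c i)) fun st hst =>
        hw st.bond (two_block_of_mem_loopWalk hj c i hst).1 (two_block_of_mem_loopWalk hj c i hst).2
      exact holT_coe_eq_exp_walkSum S w _ _ fun st hst => hS st.bond (two_block_of_mem_loopWalk hj c i hst).1 (two_block_of_mem_loopWalk hj c i hst).2
    · exact holT_coe_eq_exp_walkSum S w _ _ fun st hst => hS st.bond (two_block_of_mem_lineWalk hj c hst).1 (two_block_of_mem_lineWalk hj c hst).2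
  rw [coe_dbarAvgU, Units.val_inv_eq_inv_val, hframe c.src (Or.inl rfl), hframe c.tgt (Or.inr rfl), havg, ← Complex.exp_neg, ← Complex.exp_add,
    ← Complex.exp_add, ← Complex.exp_add, abelian_exponent_eq]

/-- `blk = iterBlockOf` (the two block-tower maps of the tree agree). [folklore] -/
theorem blk_eq_iterBlockOf : ∀ (k : ℕ) (x : Site P 0), BIJ85GaugeFunction5113.blk k x = iterBlockOf k x
  | 0, _ => rfl
  | k + 1, x => by
    show blockOf (BIJ85GaugeFunction5113.blk k x) = blockOf (iterBlockOf k x)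
    rw [blk_eq_iterBlockOf k x]

/-- `Q_k` commutes with a complex scalar on scalar fields. [cite: Balaban1984PropagatorsI, (1.18) p.20] -/
theorem bondAvgIter_const_mul (a : ℂ) (k : ℕ) (z : PBond P 0 → ℂ) (e : PBond P k) :
    bondAvgIter k (fun b => a * z b) e = a * bondAvgIter k z e :=
  ChartHInv.bondAvgIter_comp_apply ((LinearMap.lsmul ℂ ℂ a).restrictScalars ℝ) k z e

/-- **THE DOUBLE-BAR TOWER AT `𝔸 = ℂ` IS EXACT ON THE READ TERRITORY**: `U̿^{(i)}(e^{iηz})(e) = exp(iη·Lⁱ·(Q_i z)(e))` for every `e` with both ends in `S`, provided `|z(b)| ≤ t` on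
the fine bonds of the block tower over `S` and `2ℓ·|η|·Lⁱ·t ≤ 1`. [cite: Balaban1985Averaging, Prop. 4 (134)-(135) p.38; Balaban1984PropagatorsI, (1.18) p.20] -/
theorem dbarIterU_coe_eq_exp_abelian (η : ℝ) :
    ∀ (i : ℕ), i ≤ P.m + P.K → ∀ (S : Set (Site P i)) (z : PBond P 0 → ℂ) (t : ℝ), 0 ≤ t →
      2 * (((P.d + 2) * P.L : ℕ) : ℝ) * (|η| * (P.L : ℝ) ^ i * t) ≤ 1 →
      (∀ b : PBond P 0, iterBlockOf i b.src ∈ S → iterBlockOf i b.tgt ∈ S → ‖z b‖ ≤ t) →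
      ∀ e : PBond P i, e.src ∈ S → e.tgt ∈ S →
        ((dbarIterU i (expCfg η z) e : ℂˣ) : ℂ) = Complex.exp ((Complex.I * (η : ℂ)) * ((P.L : ℂ) ^ i * bondAvgIter i z e))
  | 0, _, S, z, t, _, _, _, e, _, _ => by
    rw [dbarIterU_zero, coe_expCfg, Complex.exp_eq_exp_ℂ, smul_eq_mul, pow_zero, one_mul]; rfl
  | i + 1, hi, S, z, t, ht0, hsmall, hz, c, hcs, hct => by
    have hL1 : (1 : ℝ) ≤ P.L := by exact_mod_cast P.L_pos
    set S' : Set (Site P i) := {y | blockOf y ∈ S} with hS'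
    have hz' : ∀ b : PBond P 0, iterBlockOf i b.src ∈ S' → iterBlockOf i b.tgt ∈ S' → ‖z b‖ ≤ t :=
      fun b hs ht => hz b (by rw [iterBlockOf_succ]; exact hs) (by rw [iterBlockOf_succ]; exact ht)
    have hsmall_i : 2 * (((P.d + 2) * P.L : ℕ) : ℝ) * (|η| * (P.L : ℝ) ^ i * t) ≤ 1 := by
      refine le_trans ?_ hsmall
      have hηt : 0 ≤ |η| * t := mul_nonneg (abs_nonneg η) ht0
      have hpow : (P.L : ℝ) ^ i ≤ (P.L : ℝ) ^ (i + 1) := pow_le_pow_right₀ hL1 (Nat.le_succ i)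
      have hℓ0 : (0 : ℝ) ≤ 2 * (((P.d + 2) * P.L : ℕ) : ℝ) := by positivity
      nlinarith [mul_le_mul_of_nonneg_left hpow hηt]
    have IH := dbarIterU_coe_eq_exp_abelian η i (Nat.le_of_succ_le hi) S' z t ht0 hsmall_i hz'
    have hmem : ∀ b : PBond P i, (blockOf b.src = c.src ∨ blockOf b.src = c.tgt) → (blockOf b.tgt = c.src ∨ blockOf b.tgt = c.tgt) →
        b.src ∈ S' ∧ b.tgt ∈ S' := by
      intro b hbs hbt
      refine ⟨show blockOf b.src ∈ S from ?_, show blockOf b.tgt ∈ S from ?_⟩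
      · rcases hbs with h | h <;> rw [h]; exacts [hcs, hct]
      · rcases hbt with h | h <;> rw [h]; exacts [hcs, hct]
    -- the level-`i` exponents and their size on the two blocks of `c`
    have hwb : ∀ b : PBond P i, b.src ∈ S' → b.tgt ∈ S' → ‖(Complex.I * (η : ℂ)) * ((P.L : ℂ) ^ i * bondAvgIter i z b)‖ ≤ |η| * (P.L : ℝ) ^ i * t := by
      intro b hs ht
      have hQ : ‖bondAvgIter i z b‖ ≤ t :=
        norm_bondAvgIter_le_tower i (Nat.le_of_succ_le hi) S' z t (fun b' h1 h2 => hz' b' (by rw [← blk_eq_iterBlockOf]; exact h1)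
          (by rw [← blk_eq_iterBlockOf]; exact h2)) b hs ht
      rw [norm_mul, norm_mul, norm_mul, Complex.norm_I, one_mul, Complex.norm_real, Real.norm_eq_abs, norm_pow, Complex.norm_natCast, mul_assoc]
      gcongr
    rw [dbarIterU_succ, dbarAvgU_coe_eq_exp_abelian hi c (by positivity : 0 ≤ |η| * (P.L : ℝ) ^ i * t) hsmall_i
      (fun b hbs hbt => IH b (hmem b hbs hbt).1 (hmem b hbs hbt).2) (fun b hbs hbt => hwb b (hmem b hbs hbt).1 (hmem b hbs hbt).2)]
    congr 1
    show (P.L : ℝ) • bondAvg (fun b => (Complex.I * (η : ℂ)) * ((P.L : ℂ) ^ i * bondAvgIter i z b)) c = _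
    have hfun : (fun b => (Complex.I * (η : ℂ)) * ((P.L : ℂ) ^ i * bondAvgIter i z b)) =
        fun b => (Complex.I * (η : ℂ) * (P.L : ℂ) ^ i) * bondAvgIter i z b := funext fun b => by ring
    rw [hfun, show bondAvg (fun b => (Complex.I * (η : ℂ) * (P.L : ℂ) ^ i) * bondAvgIter i z b) c =
      bondAvgIter (i + 1) (fun b => (Complex.I * (η : ℂ) * (P.L : ℂ) ^ i) * z b) c from ?_, bondAvgIter_const_mul,
      RCLike.real_smul_eq_coe_smul (K := ℂ), smul_eq_mul, pow_succ]
    · push_cast; ring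
    · show _ = bondAvg (bondAvgIter i (fun b => (Complex.I * (η : ℂ) * (P.L : ℂ) ^ i) * z b)) c
      congr 1
      funext b
      rw [bondAvgIter_const_mul]

end Step

/-! ## §3 The double-bar chart at `𝔸 = ℂ` is its linearisation; the remainder of the `M₂(ℂ)` chart is traceless-valued -/

section Traceless

/-- ★★ **`Q♭_ℂ(z)(j,c) = η·Lʲ·(Q_j z)(c)`**: at `𝔸 = ℂ` the double-bar chart IS the linear multi-level average (index form; `|z(b)| ≤ t` on the reads of the index, `2ℓ|η|Lʲt ≤ 1`).
[cite: Balaban1985Variational, (20) p.281, (44)-(48) p.285] -/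
theorem chartLogFlat_abelian_of_reads (η : ℝ) (D : Domains P) (idx : BondIdx D) (z : PBond P 0 → ℂ) {t : ℝ} (ht0 : 0 ≤ t)
    (hsmall : 2 * (((P.d + 2) * P.L : ℕ) : ℝ) * (|η| * (P.L : ℝ) ^ (idx.1.1 : ℕ) * t) ≤ 1)
    (hz : ∀ b : PBond P 0, (iterBlockOf (idx.1.1 : ℕ) b.src = idx.1.2.src ∨ iterBlockOf (idx.1.1 : ℕ) b.src = idx.1.2.tgt) →
      (iterBlockOf (idx.1.1 : ℕ) b.tgt = idx.1.2.src ∨ iterBlockOf (idx.1.1 : ℕ) b.tgt = idx.1.2.tgt) → ‖z b‖ ≤ t) :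
    chartLogFlat η D z idx = ((η : ℂ) * (P.L : ℂ) ^ (idx.1.1 : ℕ)) * bondAvgIter (idx.1.1 : ℕ) z idx.1.2 := by
  have hj : (idx.1.1 : ℕ) ≤ P.m + P.K := (Nat.lt_succ_iff.mp idx.1.1.isLt).trans D.hk
  set S : Set (Site P (idx.1.1 : ℕ)) := {y | y = idx.1.2.src ∨ y = idx.1.2.tgt} with hS
  have htow := dbarIterU_coe_eq_exp_abelian η (idx.1.1 : ℕ) hj S z t ht0 hsmall (fun b hs ht => hz b hs ht) idx.1.2 (Or.inl rfl) (Or.inr rfl)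
  -- the exponent is below `ln 2`
  have hQ : ‖bondAvgIter (idx.1.1 : ℕ) z idx.1.2‖ ≤ t :=
    norm_bondAvgIter_le_tower (idx.1.1 : ℕ) hj S z t (fun b' h1 h2 => hz b' (by rw [← blk_eq_iterBlockOf]; exact h1) (by rw [← blk_eq_iterBlockOf]; exact h2))
      idx.1.2 (Or.inl rfl) (Or.inr rfl)
  have hℓ1 : (1 : ℝ) ≤ (((P.d + 2) * P.L : ℕ) : ℝ) := by
    exact_mod_cast Nat.one_le_iff_ne_zero.mpr (Nat.mul_ne_zero (by omega) (by have := P.hL.2; omega))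
  have hexp_lt : ‖(Complex.I * (η : ℂ)) * ((P.L : ℂ) ^ (idx.1.1 : ℕ) * bondAvgIter (idx.1.1 : ℕ) z idx.1.2)‖ < Real.log 2 := by
    rw [norm_mul, norm_mul, norm_mul, Complex.norm_I, one_mul, Complex.norm_real, Real.norm_eq_abs, norm_pow, Complex.norm_natCast]
    have := Real.log_two_gt_d9
    have h0 : 0 ≤ |η| * (P.L : ℝ) ^ (idx.1.1 : ℕ) := by positivity
    nlinarith [mul_le_mul_of_nonneg_left hQ h0]
  rw [chartLogFlat_apply, htow, Complex.exp_eq_exp_ℂ, mlog_exp hexp_lt, smul_eq_mul, ← mul_assoc, ← mul_assoc, ← mul_assoc, neg_mul, Complex.I_mul_I, neg_neg, one_mul]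

open scoped Matrix.Norms.L2Operator

/-- ★★★ **THE REMAINDER OF THE DOUBLE-BAR CHART IS TRACELESS-VALUED ON THE WHOLE BALL**: for EVERY `A` in the weighted ball of record (`60800·ℓ²·L·R ≤ 1`, level weights, collar) and
every index, `tr (C♭ A)(j,c) = tr (Q♭(A)(j,c) − Q_lin(A)(j,c)) = 0` — the determinant passes through the tower (✓`trace_chartLogFlat_eq_weightedBall₀`), the scalar chart is exact
(`chartLogFlat_abelian_of_reads`) and equals the trace of CERT-2's `Q_lin = η·Lʲ·Q_j`. [cite: Balaban1985Variational, (47)-(48) p.285] -/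
theorem trace_chartRemainderFlat_eq_zero_weightedBall₀ (F : T3Family) (n K : ℕ) (D : Domains (F.P K)) (hDk : D.k = K - n)
    (hcollar : ∀ (i : ℕ) (e : PBond (F.P K) (i + 1)), D.LamBond (i + 1) e → ∀ z : Site (F.P K) i, (blockOf z = e.src ∨ blockOf z = e.tgt) → z ∈ D.Om i)
    {w : ℕ → PBond (F.P K) 0 → ℝ} (hw : IsLevWeight F n K D w)
    {R : ℝ} (hR : 16 * 3800 * ((((F.P K).d + 2) * (F.P K).L : ℕ) : ℝ) ^ 2 * (F.L : ℝ) * R ≤ 1)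
    {A : PBond (F.P K) 0 → Matrix (Fin 2) (Fin 2) ℂ} (hA : ∀ b, w 1 b * ‖A b‖ < R) (idx : BondIdx D) :
    Matrix.trace (chartLogFlat (((F.L : ℝ)⁻¹) ^ (K - n)) D A idx -
      (fderiv ℂ (chartLogFlat (((F.L : ℝ)⁻¹) ^ (K - n)) D : (PBond (F.P K) 0 → Matrix (Fin 2) (Fin 2) ℂ) → BondIdx D → Matrix (Fin 2) (Fin 2) ℂ) 0) A idx) = 0 := by
  have hL1 : (1 : ℝ) ≤ F.L := by exact_mod_cast (F.P K).L_pos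
  have hL0 : (0 : ℝ) < F.L := by linarith
  have hLF : ((F.P K).L : ℝ) = F.L := by norm_cast
  -- the trace field and its size on the reads of the index
  set t : ℝ := 2 * (F.L : ℝ) * R * (|((F.L : ℝ)⁻¹) ^ (K - n)| * (F.L : ℝ) ^ (idx.1.1 : ℕ))⁻¹ with ht
  have hη0 : 0 < |((F.L : ℝ)⁻¹) ^ (K - n)| := abs_pos.2 (pow_ne_zero _ (inv_ne_zero hL0.ne'))
  have hLj : 0 < (F.L : ℝ) ^ (idx.1.1 : ℕ) := by positivity
  have hz : ∀ b : PBond (F.P K) 0, (iterBlockOf (idx.1.1 : ℕ) b.src = idx.1.2.src ∨ iterBlockOf (idx.1.1 : ℕ) b.src = idx.1.2.tgt) →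
      (iterBlockOf (idx.1.1 : ℕ) b.tgt = idx.1.2.src ∨ iterBlockOf (idx.1.1 : ℕ) b.tgt = idx.1.2.tgt) → ‖Matrix.trace (A b)‖ ≤ t := by
    intro b hb _
    have hread := weighted_read_bound F n K D hDk hcollar hw hA idx b hb
    have htr := FlatPlaqDeriv.norm_trace_le_two_mul (A b)
    rw [ht, le_mul_inv_iff₀ (mul_pos hη0 hLj), abs_of_pos (pow_pos (inv_pos.2 hL0) _)]
    nlinarith [mul_nonneg (pow_pos (inv_pos.2 hL0) (K - n)).le hLj.le]
  have hsmall : 2 * ((((F.P K).d + 2) * (F.P K).L : ℕ) : ℝ) * (|((F.L : ℝ)⁻¹) ^ (K - n)| * ((F.P K).L : ℝ) ^ (idx.1.1 : ℕ) * t) ≤ 1 := by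
    rw [hLF, ht]
    have hℓ0 : (0 : ℝ) ≤ ((((F.P K).d + 2) * (F.P K).L : ℕ) : ℝ) := by positivity
    have hℓ1 : (1 : ℝ) ≤ ((((F.P K).d + 2) * (F.P K).L : ℕ) : ℝ) := by
      exact_mod_cast Nat.one_le_iff_ne_zero.mpr (Nat.mul_ne_zero (by omega) (by have := (F.P K).hL.2; omega))
    have hR0 : 0 ≤ R := by
      have := hA (⟨fun _ => 0, idx.1.2.dir⟩ : PBond (F.P K) 0)
      have hw0 : 0 ≤ w 1 ⟨fun _ => 0, idx.1.2.dir⟩ * ‖A ⟨fun _ => 0, idx.1.2.dir⟩‖ := by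
        rw [hw 1, pow_one]; exact mul_nonneg (by positivity) (norm_nonneg _)
      linarith
    field_simp
    have hx : 0 ≤ ((((F.P K).d + 2) * (F.P K).L : ℕ) : ℝ) * (F.L : ℝ) * R := mul_nonneg (mul_nonneg hℓ0 hL0.le) hR0
    have hx' : ((((F.P K).d + 2) * (F.P K).L : ℕ) : ℝ) * (F.L : ℝ) * R ≤ ((((F.P K).d + 2) * (F.P K).L : ℕ) : ℝ) ^ 2 * (F.L : ℝ) * R := by
      have := mul_le_mul_of_nonneg_right hℓ1 hx
      nlinarith
    nlinarith
  -- the trace as an `ℝ`-linear map, to pass it through `Q_j`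
  let τ : Matrix (Fin 2) (Fin 2) ℂ →ₗ[ℝ] ℂ := (Matrix.traceLinearMap (Fin 2) ℂ ℂ).restrictScalars ℝ
  have hτ : (fun b => Matrix.trace (A b)) = fun b => τ (A b) := rfl
  have hR0 : 0 ≤ R := by
    have := hA (⟨fun _ => 0, idx.1.2.dir⟩ : PBond (F.P K) 0)
    have hw0 : 0 ≤ w 1 ⟨fun _ => 0, idx.1.2.dir⟩ * ‖A ⟨fun _ => 0, idx.1.2.dir⟩‖ := by
      rw [hw 1, pow_one]; exact mul_nonneg (by positivity) (norm_nonneg _)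
    linarith
  have ht0 : 0 ≤ t := by rw [ht]; positivity
  rw [Matrix.trace_sub, trace_chartLogFlat_eq_weightedBall₀ F n K D hDk hcollar hw hR hA idx, chartLogFlat_abelian_of_reads _ D idx _ ht0 hsmall hz,
    fderiv_chartLogFlat_zero_apply, Matrix.trace_smul, smul_eq_mul, hτ, ChartHInv.bondAvgIter_comp_apply τ, sub_eq_zero]
  rfl

/-- ★★ **ANY SOLUTION OF (49) IS TRACELESS, AND SO IS THE DRESSED FIELD** (no uniqueness needed): if `Dv = C♭(A′ − Hs Dv)` with the dressed point in the weighted ball, then `tr (Dv c) = 0`;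
if moreover `A′` is bondwise traceless and `Hs` is trace-compatible (`tr` of `Hs X b` vanishes when every `tr (X c)` does — the real-kernel extension), the dressed competitor `A′ − Hs Dv`
is bondwise traceless — the `hU` input of ✓`tracePairing_of_isMinOn_dressed_wilson_su2` via ✓`exists_su2Chart`. [cite: Balaban1985Variational, (47)-(49) pp.285-286, (157)-(158) p.302] -/
theorem trace_dsel_eq_zero_of_eq49 (F : T3Family) (n K : ℕ) (D : Domains (F.P K)) (hDk : D.k = K - n)
    (hcollar : ∀ (i : ℕ) (e : PBond (F.P K) (i + 1)), D.LamBond (i + 1) e → ∀ z : Site (F.P K) i, (blockOf z = e.src ∨ blockOf z = e.tgt) → z ∈ D.Om i)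
    {w : ℕ → PBond (F.P K) 0 → ℝ} (hw : IsLevWeight F n K D w)
    {R : ℝ} (hR : 16 * 3800 * ((((F.P K).d + 2) * (F.P K).L : ℕ) : ℝ) ^ 2 * (F.L : ℝ) * R ≤ 1)
    (Hs : (BondIdx D → Matrix (Fin 2) (Fin 2) ℂ) → (PBond (F.P K) 0 → Matrix (Fin 2) (Fin 2) ℂ))
    (hHs : ∀ X, (∀ c, Matrix.trace (X c) = 0) → ∀ b, Matrix.trace (Hs X b) = 0)
    {A' : PBond (F.P K) 0 → Matrix (Fin 2) (Fin 2) ℂ} {Dv : BondIdx D → Matrix (Fin 2) (Fin 2) ℂ}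
    (hball : ∀ b, w 1 b * ‖(A' - Hs Dv) b‖ < R)
    (h49 : chartLogFlat (((F.L : ℝ)⁻¹) ^ (K - n)) D (A' - Hs Dv) -
        (fderiv ℂ (chartLogFlat (((F.L : ℝ)⁻¹) ^ (K - n)) D : (PBond (F.P K) 0 → Matrix (Fin 2) (Fin 2) ℂ) → BondIdx D → Matrix (Fin 2) (Fin 2) ℂ) 0) (A' - Hs Dv) = Dv) :
    (∀ c, Matrix.trace (Dv c) = 0) ∧ ((∀ b, Matrix.trace (A' b) = 0) → ∀ b, Matrix.trace ((A' - Hs Dv) b) = 0) := by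
  have hDv : ∀ c, Matrix.trace (Dv c) = 0 := fun c => by
    rw [← h49]
    exact trace_chartRemainderFlat_eq_zero_weightedBall₀ F n K D hDk hcollar hw hR hball c
  exact ⟨hDv, fun hA' b => by rw [Pi.sub_apply, Matrix.trace_sub, hA' b, hHs Dv hDv b, sub_zero]⟩

end Traceless

end Summit.QuantumFields.YangMills.Theorems.Prop8ChartDoubleBar

end
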